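import Literature.Analysis.FluidPDE.MollifiedNSRTripleBounds
import HarnessLib

/-!
# The localized mollified Navier–Stokes–Reynolds package: locality of the mollified stress,
  `C¹` data of the commutator stress and second time derivatives

Analysis/FluidPDE support file (everything proved), a companion of `MollifiedNSRTripleBounds`
(Buckmaster–Vicol, Ann. of Math. 189 (2019), §4.1 (4.2)–(4.7); EMS Surv. 6 (2019), §7.3) adding to the
package `Torus.exists_mollified_nsr_package` the three pieces of information that the ENERGY iteration
of Buckmaster–Vicol 2019, Prop. 2.1 / §7 uses and the energy-free package does not record:

* **locality in time of the mollified stress** (`M(t) = 0` as soon as `R ≡ 0` on the `7ℓ`-window of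
  `[0, T]` around `t`; BV 2019, §7 p. 42: "if `R̊_q ≡ 0` on a time interval then `R̊_ℓ ≡ 0` on the
  `ℓ`-shrunken interval");
* **the split of the carried stress** `R_c = R_comm + ℛ R_def` into the traceless commutator and the
  antidivergence of the reparametrisation defect, with sup bounds of the space and time derivatives of
  `R_comm` and of `R_def` (crude, `ℓ⁻¹`-lossy bounds suffice downstream: they enter only the `C¹` size of
  the new stress, BV (2.4));
* **second time derivatives** of the space–time mollified field (`∂ₜ²V = ℳ_{ρ″, k} U`,
  `‖∂ₜ²V‖ ≤ c₂ ℓ⁻² ‖U‖_∞` with `c₂ = ∫|ρ₁″|`), hence of the mollified velocity (they enter the second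
  derivative of the energy profile `t ↦ ∫|v_ℓ|²`, which drives the time cut-offs of the energy iteration).

## References

* T. Buckmaster, V. Vicol, Ann. of Math. 189 (2019) = arXiv:1709.10033, §4.1 (4.2)–(4.7), §7. [`BuckmasterVicol2019Annals`]
* T. Buckmaster, V. Vicol, EMS Surv. Math. Sci. 6 (2019) = arXiv:1901.09023, §7.3 (7.7)–(7.10). [`BuckmasterVicol2020`]
-/

noncomputable section

open MeasureTheory TopologicalSpace Set Function Filter Metric ContinuousLinearMap
open _root_.Topology
open scoped ENNReal NNReal Convolution InnerProductSpace ContDiff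

namespace Literature.Analysis.FluidPDE

namespace Torus

open FunctionSpaces.Torus (stLift lift kernel IsSmooth IsContDiff IsDivFree HasZeroMean mollifiedField vecMollify
  timeBump timeBumpDerivMass gradProfileMass derivProfileMass)
open FunctionSpaces (timeAvgWith)

variable {d : Type*} [Fintype d] [DecidableEq d]

/-! ## The second derivative of the scaled normalised time bump -/

section TimeBump2

variable {τ : ℝ} (hτ : 0 < τ)
include hτ

omit [Fintype d] [DecidableEq d] in
/-- The normalised scaled bump is smooth. [folklore] -/
theorem contDiff_timeBump_normed : ContDiff ℝ ∞ ((timeBump hτ).normed volume) :=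
  (timeBump hτ).contDiff_normed

omit [Fintype d] [DecidableEq d] in
/-- The derivative of the normalised scaled bump is `C¹` (indeed smooth). [folklore] -/
theorem contDiff_one_deriv_timeBump_normed : ContDiff ℝ 1 (deriv ((timeBump hτ).normed volume)) := by
  have h : ContDiff ℝ (1 + 1) ((timeBump hτ).normed volume) := (timeBump hτ).contDiff_normed
  exact ((contDiff_succ_iff_deriv (n := 1)).1 h).2.2

omit [Fintype d] [DecidableEq d] in
/-- The derivative of the normalised scaled bump has compact support. [folklore] -/
theorem hasCompactSupport_deriv_timeBump_normed : HasCompactSupport (deriv ((timeBump hτ).normed volume)) :=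
  (timeBump hτ).hasCompactSupport_normed.deriv

omit [Fintype d] [DecidableEq d] in
/-- **Scaling of the second derivative**: `((ρ_τ)″)(x) = τ⁻³ (ρ₁″)(x/τ)`. [folklore] -/
theorem deriv_deriv_timeBump_normed (x : ℝ) :
    deriv (deriv ((timeBump hτ).normed volume)) x =
      τ⁻¹ * τ⁻¹ * τ⁻¹ * deriv (deriv ((timeBump one_pos).normed volume)) (x / τ) := by
  have hfun : deriv ((timeBump hτ).normed volume) =
      fun x => τ⁻¹ * τ⁻¹ * deriv ((timeBump one_pos).normed volume) (x / τ) :=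
    funext (FunctionSpaces.Torus.deriv_timeBump_normed hτ)
  have hd : Differentiable ℝ (deriv ((timeBump one_pos).normed volume)) :=
    (contDiff_one_deriv_timeBump_normed one_pos).differentiable one_ne_zero
  rw [hfun]
  have h1 : HasDerivAt (fun x => deriv ((timeBump one_pos).normed volume) (x / τ))
      (deriv (deriv ((timeBump one_pos).normed volume)) (x / τ) * τ⁻¹) x := by
    have h := (hd (x / τ)).hasDerivAt.comp x ((hasDerivAt_id x).div_const τ)
    convert h using 1 <;> first | rfl | rw [one_div]
  rw [(h1.const_mul (τ⁻¹ * τ⁻¹)).deriv]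
  ring

omit [Fintype d] [DecidableEq d] in
/-- **`τ² ∫ |ρ_τ″| = ∫ |ρ₁″|`**: the `L¹` mass of the second derivative of the scaled normalised bump.
[folklore] -/
theorem integral_norm_deriv_deriv_timeBump_normed :
    ∫ x, ‖deriv (deriv ((timeBump hτ).normed volume)) x‖ =
      τ⁻¹ * τ⁻¹ * ∫ x, ‖deriv (deriv ((timeBump one_pos).normed volume)) x‖ := by
  simp_rw [deriv_deriv_timeBump_normed hτ, norm_mul, Real.norm_eq_abs, abs_inv, abs_of_pos hτ]
  rw [integral_const_mul,
    MeasureTheory.Measure.integral_comp_div (fun x => |deriv (deriv ((timeBump one_pos).normed volume)) x|) τ,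
    abs_of_pos hτ, smul_eq_mul]
  field_simp

omit [Fintype d] [DecidableEq d] in
/-- The second derivative of the scaled normalised bump is integrable. [folklore] -/
theorem integrable_deriv_deriv_timeBump_normed : Integrable (deriv (deriv ((timeBump hτ).normed volume))) volume :=
  ((contDiff_one_deriv_timeBump_normed hτ).continuous_deriv le_rfl).integrable_of_hasCompactSupport
    (hasCompactSupport_deriv_timeBump_normed hτ).deriv

omit [Fintype d] [DecidableEq d] hτ in
/-- The `L¹` mass of `ρ₁″` is nonnegative. [folklore] -/
theorem integral_norm_deriv_deriv_timeBump_normed_nonneg :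
    0 ≤ ∫ x, ‖deriv (deriv ((timeBump one_pos).normed volume)) x‖ :=
  integral_nonneg fun _ => norm_nonneg _

end TimeBump2

/-! ## Second time derivatives of the space–time mollified field -/

section SecondTimeDeriv

variable {W : ℝ → UnitAddTorus d → EuclideanSpace ℝ d} {φ : ContDiffBump (0 : ℝ)} {ε A T₀ : ℝ}

variable (hWm : StronglyMeasurable (uncurry W)) (hWb : ∀ s y, ‖W s y‖ ≤ A)
  (hW0 : ∀ s, s ∉ Icc 0 T₀ → W s = 0) (hε : 0 < ε) (hε' : ε ≤ 1 / 4)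
include hWm hWb hW0 hε hε'

omit [DecidableEq d] in
/-- **The second time derivative of the mollified field**:
`∂ₜ(∂ₜVᵢ)(t, x) = timeAvgWith ρ″ (s ↦ Wᵢ(s) ⋆ k_ε) t x`. [folklore] -/
theorem hasDerivAt_timeDeriv_mollifiedField_apply (t : ℝ) (x : UnitAddTorus d) (i : d) :
    HasDerivAt (fun τ => FunctionSpaces.Torus.timeDeriv (mollifiedField φ ε W) τ x i)
      (timeAvgWith (deriv (deriv (φ.normed volume))) (fun s => (fun y => W s y i) ⋆ kernel ε) t x) t := by
  have hWi : Integrable (uncurry W) ((volume : Measure ℝ).prod volume) := integrable_uncurry_of_bounded hWm hWb hW0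
  have hfun : (fun τ => FunctionSpaces.Torus.timeDeriv (mollifiedField φ ε W) τ x i) =
      fun τ => timeAvgWith (deriv (φ.normed volume)) (fun s => (fun y => W s y i) ⋆ kernel ε) τ x :=
    funext fun τ => timeDeriv_mollifiedField_apply hWm hWi hε hε' τ x i
  rw [hfun]
  have h2 : ContDiff ℝ (1 + 1) (φ.normed volume) := φ.contDiff_normed
  refine FunctionSpaces.Torus.hasDerivAt_timeAvgWith ((contDiff_succ_iff_deriv (n := 1)).1 h2).2.2
    φ.hasCompactSupport_normed.deriv ?_ t
  exact locallyIntegrable_convolution_fibre hWm hWb i (FunctionSpaces.Torus.continuous_kernel hε hε') x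

omit [DecidableEq d] in
/-- The second time derivative of the mollified field in coordinates. [folklore] -/
theorem timeDeriv_timeDeriv_mollifiedField_apply (t : ℝ) (x : UnitAddTorus d) (i : d) :
    FunctionSpaces.Torus.timeDeriv (FunctionSpaces.Torus.timeDeriv (mollifiedField φ ε W)) t x i =
      timeAvgWith (deriv (deriv (φ.normed volume))) (fun s => (fun y => W s y i) ⋆ kernel ε) t x := by
  have h := hasDerivAt_of_apply fun i => hasDerivAt_timeDeriv_mollifiedField_apply (φ := φ) hWm hWb hW0 hε hε' t x i
  rw [FunctionSpaces.Torus.timeDeriv, h.deriv]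

/-- **Space derivatives of the time derivative**: `∂ₗ(∂ₜV)ᵢ(t, x) = timeAvgWith ρ' (s ↦ Wᵢ(s) ⋆ ∂ₗk_ε) t x`.
[folklore] -/
theorem partialDeriv_timeDeriv_mollifiedField_apply (hV : ContDiff ℝ ∞ (stLift (FunctionSpaces.Torus.timeDeriv (mollifiedField φ ε W))))
    (t : ℝ) (x : UnitAddTorus d) (l i : d) :
    FunctionSpaces.Torus.partialDeriv l (FunctionSpaces.Torus.timeDeriv (mollifiedField φ ε W) t) x i =
      timeAvgWith (deriv (φ.normed volume)) (fun s => (fun y => W s y i) ⋆ FunctionSpaces.Torus.partialDeriv l (kernel ε)) t x := by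
  have hWi : Integrable (uncurry W) ((volume : Measure ℝ).prod volume) := integrable_uncurry_of_bounded hWm hWb hW0
  have hsm : IsSmooth (FunctionSpaces.Torus.timeDeriv (mollifiedField φ ε W) t) :=
    (FunctionSpaces.Torus.isSmoothSpaceTimeOn_of_contDiff hV univ).isSmooth_slice (mem_univ t)
  have hfun : (fun y => FunctionSpaces.Torus.timeDeriv (mollifiedField φ ε W) t y i) =
      (timeAvgWith (deriv (φ.normed volume)) (fun s y => W s y i) t) ⋆ kernel ε := by
    funext y
    rw [timeDeriv_mollifiedField_apply hWm hWi hε hε' t y i,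
      FunctionSpaces.Torus.timeAvgWith_convolution (FunctionSpaces.Torus.integrable_uncurry_apply hWi i)
        ((φ.contDiff_normed (n := 1)).continuous_deriv le_rfl) φ.hasCompactSupport_normed.deriv
        (FunctionSpaces.Torus.continuous_kernel hε hε') t]
  rw [← FunctionSpaces.Torus.partialDeriv_apply_coord (hsm.isContDiff (by simp)) l x i, hfun,
    FunctionSpaces.Torus.partialDeriv_convolution_timeAvgWith (FunctionSpaces.Torus.integrable_uncurry_apply hWi i)
      ((φ.contDiff_normed (n := 1)).continuous_deriv le_rfl) φ.hasCompactSupport_normed.deriv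
      (FunctionSpaces.Torus.isSmooth_kernel hε hε') t l]

end SecondTimeDeriv

section SecondTimeDerivBounds

variable {U : ℝ → UnitAddTorus d → EuclideanSpace ℝ d} {M H β T₀ τ ε : ℝ}

omit [DecidableEq d] in
/-- **`|∂ₜ²Vᵢ| ≤ c₂ τ⁻² M`** (`∂ₜ²Vᵢ = ℳ_{ρ″, k} Uᵢ`, `∫|ρ_τ″| = c₂ τ⁻²`). [folklore] -/
theorem norm_timeDeriv_timeDeriv_mollifiedField_apply_le (hU : HolderSlabData U M H β T₀) (hτ : 0 < τ)
    (hε : 0 < ε) (hε' : ε ≤ 1 / 4) (t : ℝ) (x : UnitAddTorus d) (i : d) :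
    ‖FunctionSpaces.Torus.timeDeriv (FunctionSpaces.Torus.timeDeriv (mollifiedField (timeBump hτ) ε U)) t x i‖ ≤
      τ⁻¹ * τ⁻¹ * (∫ x, ‖deriv (deriv ((timeBump one_pos).normed volume)) x‖) * M := by
  rw [timeDeriv_timeDeriv_mollifiedField_apply hU.measurable hU.bound hU.zero_off hε hε']
  have h := FunctionSpaces.Torus.norm_timeAvgWith_convolution_le_of_bound (hU.bound_apply i)
    (integrable_deriv_deriv_timeBump_normed hτ) (FunctionSpaces.Torus.continuous_kernel hε hε') t x
  rwa [integral_norm_deriv_deriv_timeBump_normed hτ, FunctionSpaces.Torus.integral_norm_kernel_eq_one hε hε',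
    mul_one] at h

/-- Vector form: `‖∂ₜ²V(t, x)‖ ≤ d c₂ τ⁻² M`. [folklore] -/
theorem norm_timeDeriv_timeDeriv_mollifiedField_le (hU : HolderSlabData U M H β T₀) (hτ : 0 < τ)
    (hε : 0 < ε) (hε' : ε ≤ 1 / 4) (t : ℝ) (x : UnitAddTorus d) :
    ‖FunctionSpaces.Torus.timeDeriv (FunctionSpaces.Torus.timeDeriv (mollifiedField (timeBump hτ) ε U)) t x‖ ≤
      Fintype.card d * (τ⁻¹ * τ⁻¹ * (∫ x, ‖deriv (deriv ((timeBump one_pos).normed volume)) x‖) * M) := by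
  refine (norm_le_sum_norm_apply _).trans ?_
  calc ∑ k, ‖FunctionSpaces.Torus.timeDeriv (FunctionSpaces.Torus.timeDeriv (mollifiedField (timeBump hτ) ε U)) t x k‖
      ≤ ∑ _k : d, τ⁻¹ * τ⁻¹ * (∫ x, ‖deriv (deriv ((timeBump one_pos).normed volume)) x‖) * M :=
        Finset.sum_le_sum fun k _ => norm_timeDeriv_timeDeriv_mollifiedField_apply_le hU hτ hε hε' t x k
    _ = _ := by rw [Finset.sum_const, Finset.card_univ, nsmul_eq_mul]

/-- **`|∂ₗ∂ₜVᵢ| ≤ c τ⁻¹ C₁ ε⁻¹ M`**. [folklore] -/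
theorem norm_partialDeriv_timeDeriv_mollifiedField_apply_le (hU : HolderSlabData U M H β T₀) (hτ : 0 < τ)
    (hε : 0 < ε) (hε' : ε ≤ 1 / 4)
    (hV : ContDiff ℝ ∞ (stLift (FunctionSpaces.Torus.timeDeriv (mollifiedField (timeBump hτ) ε U))))
    (t : ℝ) (x : UnitAddTorus d) (l i : d) :
    ‖FunctionSpaces.Torus.partialDeriv l (FunctionSpaces.Torus.timeDeriv (mollifiedField (timeBump hτ) ε U) t) x i‖ ≤
      τ⁻¹ * timeBumpDerivMass * (ε⁻¹ * gradProfileMass d) * M := by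
  have hk : IsSmooth (kernel (d := d) ε) := FunctionSpaces.Torus.isSmooth_kernel hε hε'
  rw [partialDeriv_timeDeriv_mollifiedField_apply hU.measurable hU.bound hU.zero_off hε hε' hV t x l i]
  have h := FunctionSpaces.Torus.norm_timeAvgWith_convolution_le_of_bound (hU.bound_apply i)
    (FunctionSpaces.Torus.integrable_deriv_timeBump_normed hτ) (hk.partialDeriv l).continuous t x
  rw [FunctionSpaces.Torus.integral_norm_deriv_timeBump_normed] at h
  exact h.trans (mul_le_mul_of_nonneg_right (mul_le_mul_of_nonneg_left
    (FunctionSpaces.Torus.integral_norm_partialDeriv_kernel_le hε hε' l)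
    (mul_nonneg (inv_nonneg.2 hτ.le) FunctionSpaces.Torus.timeBumpDerivMass_nonneg)) hU.M_nonneg)

/-- Vector form: `‖∂ₗ∂ₜV(t, x)‖ ≤ d c τ⁻¹ C₁ ε⁻¹ M`. [folklore] -/
theorem norm_partialDeriv_timeDeriv_mollifiedField_le (hU : HolderSlabData U M H β T₀) (hτ : 0 < τ)
    (hε : 0 < ε) (hε' : ε ≤ 1 / 4)
    (hV : ContDiff ℝ ∞ (stLift (FunctionSpaces.Torus.timeDeriv (mollifiedField (timeBump hτ) ε U))))
    (t : ℝ) (x : UnitAddTorus d) (l : d) :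
    ‖FunctionSpaces.Torus.partialDeriv l (FunctionSpaces.Torus.timeDeriv (mollifiedField (timeBump hτ) ε U) t) x‖ ≤
      Fintype.card d * (τ⁻¹ * timeBumpDerivMass * (ε⁻¹ * gradProfileMass d) * M) := by
  refine (norm_le_sum_norm_apply _).trans ?_
  calc ∑ k, ‖FunctionSpaces.Torus.partialDeriv l (FunctionSpaces.Torus.timeDeriv (mollifiedField (timeBump hτ) ε U) t) x k‖
      ≤ ∑ _k : d, τ⁻¹ * timeBumpDerivMass * (ε⁻¹ * gradProfileMass d) * M :=
        Finset.sum_le_sum fun k _ => norm_partialDeriv_timeDeriv_mollifiedField_apply_le hU hτ hε hε' hV t x l k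
    _ = _ := by rw [Finset.sum_const, Finset.card_univ, nsmul_eq_mul]

end SecondTimeDerivBounds

/-! ## The localized package -/

section Package

set_option maxHeartbeats 4000000 in
/-- **The localized mollified triple on the same interval, with all bounds** (Buckmaster–Vicol 2019, §4.1
(4.2)–(4.7) read on `[0, T]` via the reparametrisation `τ(t) = 2ℓ + (1 - 4ℓ/T)t`, as in
`Torus.exists_mollified_nsr_package`, with the localized extras). There is a constant `C ≥ 1` depending
only on `d` such that: for every classical NSR triple `(v, p, R)` with viscosity `ν` on `[0, T] × 𝕋^d`
(`d ≥ 2`) with zero-mean velocity and bounds `‖v‖ ≤ B₀`, `‖∂ᵢv‖ ≤ B₁`, `‖∂ₜv‖ ≤ Bₜ`, `‖R‖ ≤ A`,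
`∫‖R(t)‖ ≤ δ`, and every scale `0 < ℓ ≤ 1/4` with `8ℓ ≤ T`, there are `vm, pm`, stresses `R_c = R_cm + ℛ R_def`
(carried: traceless commutator plus antidivergence of the reparametrisation defect) and `M` (to be cancelled;
symmetric) with `(vm, pm, R_c + M̊)` an NSR triple with viscosity `ν` on `[0, T]`, `vm` of zero mean and with
smooth space–time lift, all the bounds of `Torus.exists_mollified_nsr_package`, and moreover:
`‖R_cm‖ ≤ C B₀ (Bₜ + B₁) ℓ`, `‖R_def‖ ≤ C T⁻¹ (Bₜ + B₁) ℓ`, `‖∂R_cm‖, ‖∂ₜR_cm‖ ≤ C B₀ (B₀ℓ⁻¹ + Bₜ + B₁)`,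
`‖∂R_def‖, ‖∂ₜR_def‖ ≤ C T⁻¹ B₀ ℓ⁻¹`, `‖∂ₜ∂ₜvm‖ ≤ C B₀ ℓ⁻²`, and the LOCALITY of the mollified stress:
if `R(s) = 0` for all `s ∈ [0, T]` with `|s - t| ≤ 7ℓ` then `M(t) = 0` (BV 2019, §7: `R̊_q ≡ 0` on an interval
forces `R̊_ℓ ≡ 0` on the `ℓ`-shrunken interval; here with the `6ℓ` time shift of the reparametrisation).
[cite: BuckmasterVicol2019Annals, §4.1 (4.2)–(4.7) and §7] -/
theorem exists_mollified_nsr_package_local (hd : 2 ≤ Fintype.card d) :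
    ∃ C : ℝ, 1 ≤ C ∧ ∀ (T ν : ℝ) (v : ℝ → UnitAddTorus d → EuclideanSpace ℝ d) (p : ℝ → UnitAddTorus d → ℝ)
      (R : ℝ → UnitAddTorus d → d → EuclideanSpace ℝ d), IsNSReynoldsOn (Icc 0 T) ν v p R → 0 < T →
      (∀ t ∈ Icc 0 T, HasZeroMean (v t)) → ∀ (B₀ B₁ Bt A δ ℓ : ℝ),
      (∀ t ∈ Icc 0 T, ∀ x, ‖v t x‖ ≤ B₀) → (∀ i, ∀ t ∈ Icc 0 T, ∀ x, ‖FunctionSpaces.Torus.partialDeriv i (v t) x‖ ≤ B₁) →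
      (∀ t ∈ Icc 0 T, ∀ x, ‖FunctionSpaces.Torus.timeDerivWithin (Icc 0 T) v t x‖ ≤ Bt) → 0 ≤ B₁ → 0 ≤ Bt →
      (∀ t ∈ Icc 0 T, ∀ x, ‖R t x‖ ≤ A) → (∀ t ∈ Icc 0 T, ∫ x, ‖R t x‖ ≤ δ) → 0 < ℓ → ℓ ≤ 1 / 4 → 8 * ℓ ≤ T →
      ∃ (vm : ℝ → UnitAddTorus d → EuclideanSpace ℝ d) (pm : ℝ → UnitAddTorus d → ℝ)
        (Rc Rcm M : ℝ → UnitAddTorus d → d → EuclideanSpace ℝ d) (Rdef : ℝ → UnitAddTorus d → EuclideanSpace ℝ d),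
        IsNSReynoldsOn (Icc 0 T) ν vm pm (fun t x j => Rc t x j + traceless (M t) x j) ∧
        (∀ t ∈ Icc 0 T, HasZeroMean (vm t)) ∧
        FunctionSpaces.Torus.IsSmoothSpaceTimeOn (Icc 0 T) Rc ∧ FunctionSpaces.Torus.IsSmoothSpaceTimeOn (Icc 0 T) M ∧
        (∀ t x (i j : d), M t x i j = M t x j i) ∧ (∀ t ∈ Icc 0 T, ∀ x (i j : d), Rc t x i j = Rc t x j i) ∧
        (∀ t x, ‖vm t x‖ ≤ C * B₀) ∧
        (∀ t ∈ Icc 0 T, ∀ x, ‖vm t x - v t x‖ ≤ C * (Bt + B₁) * ℓ) ∧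
        (∀ t ∈ Icc 0 T, ∀ x i, ‖FunctionSpaces.Torus.partialDeriv i (vm t) x‖ ≤ C * (Bt + B₁)) ∧
        (∀ t ∈ Icc 0 T, ∀ x, ‖FunctionSpaces.Torus.timeDerivWithin (Icc 0 T) vm t x‖ ≤ C * (Bt + B₁)) ∧
        (∀ t ∈ Icc 0 T, ∀ x, ‖Rc t x‖ ≤ C * (B₀ + 1 / T) * (Bt + B₁) * ℓ) ∧
        (∀ t, ∫ x, ‖M t x‖ ≤ C * δ) ∧
        (∀ t x, ‖M t x‖ ≤ C * A) ∧
        (∀ t x l, ‖FunctionSpaces.Torus.partialDeriv l (M t) x‖ ≤ C * A * ℓ⁻¹) ∧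
        (∀ t x l m, ‖FunctionSpaces.Torus.partialDeriv l (FunctionSpaces.Torus.partialDeriv m (M t)) x‖ ≤ C * A * ℓ⁻¹ ^ 2) ∧
        (∀ t ∈ Icc 0 T, ∀ x, ‖FunctionSpaces.Torus.timeDerivWithin (Icc 0 T) M t x‖ ≤ C * A * ℓ⁻¹) ∧
        (∀ t ∈ Icc 0 T, ∀ x l, ‖FunctionSpaces.Torus.timeDerivWithin (Icc 0 T)
          (fun s y => FunctionSpaces.Torus.partialDeriv l (M s) y) t x‖ ≤ C * A * ℓ⁻¹ ^ 2) ∧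
        -- the localized extras
        ContDiff ℝ ∞ (stLift vm) ∧
        (∀ t x j, Rc t x j = Rcm t x j + antidivergence (Rdef t) x j) ∧
        FunctionSpaces.Torus.IsSmoothSpaceTimeOn (Icc 0 T) Rcm ∧ FunctionSpaces.Torus.IsSmoothSpaceTimeOn (Icc 0 T) Rdef ∧
        (∀ t x (i j : d), Rcm t x i j = Rcm t x j i) ∧
        (∀ t ∈ Icc 0 T, ∀ x, ‖Rcm t x‖ ≤ C * B₀ * (Bt + B₁) * ℓ) ∧
        (∀ t ∈ Icc 0 T, ∀ x, ‖Rdef t x‖ ≤ C * (1 / T) * (Bt + B₁) * ℓ) ∧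
        (∀ t ∈ Icc 0 T, ∀ x l, ‖FunctionSpaces.Torus.partialDeriv l (Rcm t) x‖ ≤ C * B₀ * (B₀ * ℓ⁻¹ + (Bt + B₁))) ∧
        (∀ t ∈ Icc 0 T, ∀ x, ‖FunctionSpaces.Torus.timeDerivWithin (Icc 0 T) Rcm t x‖ ≤ C * B₀ * (B₀ * ℓ⁻¹ + (Bt + B₁))) ∧
        (∀ t ∈ Icc 0 T, ∀ x l, ‖FunctionSpaces.Torus.partialDeriv l (Rdef t) x‖ ≤ C * (1 / T) * B₀ * ℓ⁻¹) ∧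
        (∀ t ∈ Icc 0 T, ∀ x, ‖FunctionSpaces.Torus.timeDerivWithin (Icc 0 T) Rdef t x‖ ≤ C * (1 / T) * B₀ * ℓ⁻¹) ∧
        (∀ t ∈ Icc 0 T, ∀ x, ‖FunctionSpaces.Torus.timeDerivWithin (Icc 0 T)
          (FunctionSpaces.Torus.timeDerivWithin (Icc 0 T) vm) t x‖ ≤ C * B₀ * ℓ⁻¹ ^ 2) ∧
        (∀ t ∈ Icc 0 T, (∀ s ∈ Icc 0 T, |s - t| ≤ 7 * ℓ → ∀ y, R s y = 0) → ∀ x, M t x = 0) := by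
  haveI : Nonempty d := Fintype.card_pos_iff.1 (by omega)
  obtain ⟨K, hK0, hK⟩ := exists_norm_antidivergence_le (d := d) hd
  -- the constants
  set cd : ℝ := (Fintype.card d : ℝ) with hcd
  set mT : ℝ := timeBumpDerivMass with hmT
  set g₁ : ℝ := gradProfileMass d with hg₁
  set g₂ : ℝ := derivProfileMass d 2 with hg₂
  set m₂ : ℝ := ∫ x, ‖deriv (deriv ((timeBump one_pos).normed volume)) x‖ with hm₂
  obtain ⟨L, hLdef⟩ : ∃ L : ℝ, L = 1 + Real.sqrt cd * cd := ⟨_, rfl⟩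
  have hcd1 : 1 ≤ cd := by
    have : 1 ≤ Fintype.card d := Fintype.card_pos
    rw [hcd]; exact_mod_cast this
  have hcd0 : 0 ≤ cd := by linarith
  have hmT0 : 0 ≤ mT := FunctionSpaces.Torus.timeBumpDerivMass_nonneg
  have hg₁0 : 0 ≤ g₁ := FunctionSpaces.Torus.gradProfileMass_nonneg (d := d)
  have hg₂0 : 0 ≤ g₂ := FunctionSpaces.Torus.derivProfileMass_nonneg (d := d) 2
  have hm₂0 : 0 ≤ m₂ := integral_norm_deriv_deriv_timeBump_normed_nonneg
  have hL1 : 1 ≤ L := by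
    have : 0 ≤ Real.sqrt cd * cd := by positivity
    rw [hLdef]; linarith
  have hL0 : 0 ≤ L := by linarith
  obtain ⟨C, hCdef⟩ : ∃ C : ℝ, C = 1 + cd + (cd + 6) * L + cd * g₁ * L + cd * mT * L + (4 * (cd + 1) * cd * L + 4 * K * cd * mT * L) +
    cd * cd + cd * g₁ + cd * g₂ + cd * mT + cd * mT * g₁ +
    (4 * (cd + 1) * cd * L + 4 * cd * mT * L + (cd + 1) * (2 * cd * cd * g₁ * L + cd * g₁) +
      (cd + 1) * (2 * cd * cd * mT * L + cd * mT) + 4 * cd * mT * g₁ + 4 * cd * m₂ + cd * m₂) := ⟨_, rfl⟩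
  have hextra : 0 ≤ 4 * (cd + 1) * cd * L ∧ 0 ≤ 4 * cd * mT * L ∧ 0 ≤ (cd + 1) * (2 * cd * cd * g₁ * L + cd * g₁) ∧
      0 ≤ (cd + 1) * (2 * cd * cd * mT * L + cd * mT) ∧ 0 ≤ 4 * cd * mT * g₁ ∧ 0 ≤ 4 * cd * m₂ ∧ 0 ≤ cd * m₂ := by
    refine ⟨by positivity, by positivity, by positivity, by positivity, by positivity, by positivity, by positivity⟩
  obtain ⟨r1, r2, r3, r4, r5, r6, r7⟩ := hextra
  have hpos : 0 ≤ cd ∧ 0 ≤ (cd + 6) * L ∧ 0 ≤ cd * g₁ * L ∧ 0 ≤ cd * mT * L ∧ 0 ≤ 4 * (cd + 1) * cd * L + 4 * K * cd * mT * L ∧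
      0 ≤ cd * cd ∧ 0 ≤ cd * g₁ ∧ 0 ≤ cd * g₂ ∧ 0 ≤ cd * mT ∧ 0 ≤ cd * mT * g₁ := by
    refine ⟨hcd0, by positivity, by positivity, by positivity, by positivity, by positivity, by positivity, by positivity,
      by positivity, by positivity⟩
  obtain ⟨p1, p2, p3, p4, p5, p6, p7, p8, p9, p10⟩ := hpos
  have q1 : cd ≤ C := by rw [hCdef]; linarith
  have q2 : (cd + 6) * L ≤ C := by rw [hCdef]; linarith
  have q3 : cd * g₁ * L ≤ C := by rw [hCdef]; linarith
  have q4 : cd * mT * L ≤ C := by rw [hCdef]; linarith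
  have q5 : 4 * (cd + 1) * cd * L + 4 * K * cd * mT * L ≤ C := by rw [hCdef]; linarith
  have q6 : cd * cd ≤ C := by rw [hCdef]; linarith
  have q7 : cd * g₁ ≤ C := by rw [hCdef]; linarith
  have q8 : cd * g₂ ≤ C := by rw [hCdef]; linarith
  have q9 : cd * mT ≤ C := by rw [hCdef]; linarith
  have q10 : cd * mT * g₁ ≤ C := by rw [hCdef]; linarith
  have q11 : 4 * (cd + 1) * cd * L ≤ C := by rw [hCdef]; linarith
  have q12 : 4 * cd * mT * L ≤ C := by rw [hCdef]; linarith
  have q13 : (cd + 1) * (2 * cd * cd * g₁ * L + cd * g₁) ≤ C := by rw [hCdef]; linarith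
  have q14 : (cd + 1) * (2 * cd * cd * mT * L + cd * mT) ≤ C := by rw [hCdef]; linarith
  have q15 : 4 * cd * mT * g₁ ≤ C := by rw [hCdef]; linarith
  have q16 : 4 * cd * m₂ ≤ C := by rw [hCdef]; linarith
  have q17 : cd * m₂ ≤ C := by rw [hCdef]; linarith
  have hC1 : 1 ≤ C := by rw [hCdef]; linarith
  refine ⟨C, hC1, ?_⟩
  intro T ν v p R h hT hvmean B₀ B₁ Bt A δ ℓ h0 h1 ht hB₁ hBt hA hδ hℓ hℓ4 hℓT
  -- parameters of the mollification
  have hℓT' : ℓ < T := by linarith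
  set κ : ℝ := 1 - 4 * ℓ / T with hκdef
  set c : ℝ := 2 * ℓ with hcdef'
  have hκ0 : 0 ≤ κ := by
    rw [hκdef, sub_nonneg, div_le_one hT]; linarith
  have hκ1 : κ ≤ 1 := by
    have : 0 ≤ 4 * ℓ / T := by positivity
    rw [hκdef]; linarith
  have hκabs : |κ| ≤ 1 := abs_le.2 ⟨by linarith, hκ1⟩
  have hκm1 : |κ - 1| = 4 * ℓ / T := by
    rw [hκdef, show (1 - 4 * ℓ / T - 1 : ℝ) = -(4 * ℓ / T) by ring, abs_neg, abs_of_nonneg (by positivity)]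
  have hτt : ∀ t ∈ Icc (0 : ℝ) T, 2 * ℓ ≤ κ * t + c ∧ κ * t + c ≤ T - 2 * ℓ := by
    intro t ht'
    refine ⟨by have hkt : 0 ≤ κ * t := mul_nonneg hκ0 ht'.1; rw [hcdef']; linarith, ?_⟩
    have h1' : κ * t ≤ κ * T := mul_le_mul_of_nonneg_left ht'.2 hκ0
    have h2' : κ * T = T - 4 * ℓ := by rw [hκdef]; field_simp
    linarith
  have hwin : ∀ t ∈ Icc (0 : ℝ) T, κ * t + c ∈ Ioo (timeBump hℓ).rOut (T - (timeBump hℓ).rOut) := by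
    intro t ht'
    rw [FunctionSpaces.Torus.timeBump_rOut]
    obtain ⟨a1, a2⟩ := hτt t ht'
    exact ⟨by linarith, by linarith⟩
  have hwin' : ∀ t ∈ Icc (0 : ℝ) T, Icc (κ * t + c - ℓ) (κ * t + c + ℓ) ⊆ Icc 0 T := by
    intro t ht' s hs
    obtain ⟨a1, a2⟩ := hτt t ht'
    exact ⟨by linarith [hs.1], by linarith [hs.2]⟩
  have hdist : ∀ t ∈ Icc (0 : ℝ) T, |κ * t + c - t| ≤ 6 * ℓ := by
    intro t ht'
    have e : κ * t + c - t = 2 * ℓ - 4 * ℓ / T * t := by rw [hκdef, hcdef']; ring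
    rw [e]
    have h1' : 0 ≤ 4 * ℓ / T * t := by have := ht'.1; positivity
    have h2' : 4 * ℓ / T * t ≤ 4 * ℓ := by
      have : t / T ≤ 1 := (div_le_one hT).2 ht'.2
      have e' : 4 * ℓ / T * t = 4 * ℓ * (t / T) := by ring
      rw [e']; exact mul_le_of_le_one_right (by positivity) this
    rw [abs_le]; constructor <;> linarith
  -- data
  obtain ⟨⟨hUm, hUb, hU0, hUdiv⟩, ⟨hRUm, hRUb, hRU0, hRUsym⟩⟩ := zeroExt_data h Subset.rfl hT h0 hA
  set U := zeroExt T v with hUdef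
  set RU := zeroExt T R with hRUdef
  have hUi := integrable_uncurry_of_bounded hUm hUb hU0
  have hU' : UniqueDiffOn ℝ (Icc 0 T) := uniqueDiffOn_Icc hT
  have hcv : Convex ℝ (Icc (0 : ℝ) T) := convex_Icc 0 T
  have hint : (interior (Icc (0 : ℝ) T)).Nonempty := by rw [interior_Icc]; exact nonempty_Ioo.2 hT
  have hUv : HolderSlabData U B₀ (Bt + Real.sqrt (Fintype.card d) * Fintype.card d * B₁) 1 T :=
    holderSlabData_zeroExt hT h.smooth_velocity h0 h1 ht hB₁ hBt
  set H : ℝ := Bt + Real.sqrt (Fintype.card d) * Fintype.card d * B₁ with hHdef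
  have hH0 : 0 ≤ H := hUv.H_nonneg
  have hHL : H ≤ L * (Bt + B₁) := by
    have hs0 : 0 ≤ Real.sqrt cd * cd := by positivity
    have hsB : 0 ≤ Real.sqrt cd * cd * Bt := mul_nonneg hs0 hBt
    have e : L * (Bt + B₁) = H + (B₁ + Real.sqrt cd * cd * Bt) := by rw [hHdef, hLdef, hcd]; ring
    rw [e]; linarith
  have hcolx : ∀ j, ∃ Hj : ℝ, HolderSlabData (fun s y => RU s y j) A Hj 1 T := fun j =>
    exists_holderSlabData_stress_col h Subset.rfl hT hA j
  choose Hc hcol using hcolx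
  have hUmean : ∀ s, HasZeroMean (U s) := fun s => by
    by_cases hs : s ∈ Icc 0 T
    · rw [hUdef, zeroExt_of_mem v hs]; exact hvmean s hs
    · rw [hUdef, zeroExt_of_not_mem v hs]; show ∫ x, (0 : UnitAddTorus d → EuclideanSpace ℝ d) x = 0; simp
  -- the pressure and the triple
  obtain ⟨q, hq, hgrad, hqmean⟩ := exists_pressure_mollifiedNSRResidual (φ := timeBump hℓ) h Subset.rfl hT h0 hA hℓ hℓ4
  have hNSR := isNSReynoldsOn_reparam (φ := timeBump hℓ) hd h Subset.rfl hT h0 hA hℓ hℓ4 hq hgrad hqmean hT hwin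
  -- global smoothness of the mollified objects
  have hVg : ContDiff ℝ ∞ (stLift (mollifiedField (timeBump hℓ) ℓ U)) := contDiff_stLift_mollifiedField hUi hℓ hℓ4
  have hdVg : ContDiff ℝ ∞ (stLift (FunctionSpaces.Torus.timeDeriv (mollifiedField (timeBump hℓ) ℓ U))) :=
    (isSpaceTimeTest_mollifiedField (φ := timeBump hℓ) hUi hℓ hℓ4 hU0).timeDeriv.1
  have hFlg : ∀ j, ContDiff ℝ ∞ (stLift fun t x => mollifiedFlux (timeBump hℓ) ℓ U t x j) := fun j =>
    contDiff_stLift_mollifiedField (integrable_uncurry_smul_apply hUm hUb hU0 j) hℓ hℓ4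
  have hStg : ∀ j, ContDiff ℝ ∞ (stLift fun t x => mollifiedStress (timeBump hℓ) ℓ RU t x j) := fun j =>
    contDiff_stLift_mollifiedStress_col hRUm hRUb hRU0 hℓ hℓ4 j
  -- the four objects
  set V := mollifiedField (timeBump hℓ) ℓ U with hVdef
  set vm := reparamVelocity (timeBump hℓ) ℓ T κ c v with hvmdef
  set M : ℝ → UnitAddTorus d → d → EuclideanSpace ℝ d := fun t => mollifiedStress (timeBump hℓ) ℓ RU (κ * t + c) with hMdef
  set comm : ℝ → UnitAddTorus d → d → EuclideanSpace ℝ d := fun t y j =>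
    tensorProd (V (κ * t + c)) (V (κ * t + c)) y j - mollifiedFlux (timeBump hℓ) ℓ U (κ * t + c) y j with hcommdef
  set Rc : ℝ → UnitAddTorus d → d → EuclideanSpace ℝ d := fun t x j =>
    traceless (comm t) x j + antidivergence (reparamDefect (timeBump hℓ) ℓ T κ c v t) x j with hRcdef
  set Rcm : ℝ → UnitAddTorus d → d → EuclideanSpace ℝ d := fun t => traceless (comm t) with hRcmdef
  set Rdef : ℝ → UnitAddTorus d → EuclideanSpace ℝ d := reparamDefect (timeBump hℓ) ℓ T κ c v with hRdefdef
  -- smoothness on `[0, T]`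
  have hVs : FunctionSpaces.Torus.IsSmoothSpaceTimeOn (Icc 0 T) (fun t => V (κ * t + c)) :=
    isSmoothSpaceTimeOn_comp_affine_of_contDiff hVg _ κ c
  have hFls : FunctionSpaces.Torus.IsSmoothSpaceTimeOn (Icc 0 T) (fun t => mollifiedFlux (timeBump hℓ) ℓ U (κ * t + c)) :=
    isSmoothSpaceTimeOn_tensor_iff.2 fun j => isSmoothSpaceTimeOn_comp_affine_of_contDiff (hFlg j) _ κ c
  have hMs : FunctionSpaces.Torus.IsSmoothSpaceTimeOn (Icc 0 T) M :=
    isSmoothSpaceTimeOn_tensor_iff.2 fun j => isSmoothSpaceTimeOn_comp_affine_of_contDiff (hStg j) _ κ c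
  have hcomms : FunctionSpaces.Torus.IsSmoothSpaceTimeOn (Icc 0 T) comm := (hVs.tensorProd hVs).sub hFls
  have hdefs : FunctionSpaces.Torus.IsSmoothSpaceTimeOn (Icc 0 T) (reparamDefect (timeBump hℓ) ℓ T κ c v) :=
    (isSmoothSpaceTimeOn_comp_affine_of_contDiff hdVg _ κ c).const_smul (κ - 1)
  have hRcs : FunctionSpaces.Torus.IsSmoothSpaceTimeOn (Icc 0 T) Rc := hcomms.traceless.add (hdefs.antidivergence hcv hint)
  -- the stress of the triple is `Rc + M̊`
  have hstress : reparamStress (timeBump hℓ) ℓ T κ c v R = fun t x j => Rc t x j + traceless (M t) x j := by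
    funext t x j
    have e1 : nsrRaw (timeBump hℓ) ℓ T v R (κ * t + c) = fun y j => comm t y j + M t y j := by
      funext y j; simp only [nsrRaw, hcommdef, hMdef, hVdef, hUdef, hRUdef]
    simp only [reparamStress, hRcdef, e1, traceless_add_apply']
    abel
  have hcsym : ∀ t x i j, comm t x i j = comm t x j i := fun t x i j => by
    simp only [hcommdef, PiLp.sub_apply, tensorProd, PiLp.smul_apply, smul_eq_mul, hVdef]
    rw [mollifiedFlux_symm hUm hUb hU0 hℓ hℓ4 _ x i j]; ring
  refine ⟨vm, reparamPressure (timeBump hℓ) ℓ T κ c v R q, Rc, Rcm, M, Rdef, hstress ▸ hNSR, fun t _ => ?_, hRcs, hMs,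
    fun t x i j => ?_, fun t ht' x i j => ?_, ?_⟩
  · exact hasZeroMean_mollifiedField hUm hUb hU0 hUmean hℓ hℓ4 _
  · exact mollifiedStress_symm hRUm hRUb hRU0 hRUsym hℓ hℓ4 _ x i j
  · simp only [hRcdef, PiLp.add_apply]
    rw [traceless_symm (fun i j => hcsym t x i j) i j, antidivergence_symm (hdefs.isSmooth_slice ht') x i j]
  -- the bounds
  obtain ⟨hb1, hb2, -⟩ := norm_mollifiedField_bounds hUv hℓ hℓ hℓ4
  have hmax : max ℓ ℓ = ℓ := max_self ℓ
  have hB0 : 0 ≤ B₀ := hUv.M_nonneg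
  -- derivative data used by the localized extras
  have hψ : ContDiff ℝ ∞ (stLift vm) := by
    have hφ : ContDiff ℝ ∞ (fun z : ℝ × EuclideanSpace ℝ d => (κ * z.1 + c, z.2)) :=
      ((contDiff_const.mul contDiff_fst).add contDiff_const).prodMk contDiff_snd
    change ContDiff ℝ ∞ (stLift (mollifiedField (timeBump hℓ) ℓ U) ∘ fun z : ℝ × EuclideanSpace ℝ d => (κ * z.1 + c, z.2))
    exact hVg.comp hφ
  have hdV : ∀ t ∈ Icc (0 : ℝ) T, ∀ x, ‖FunctionSpaces.Torus.timeDeriv V (κ * t + c) x‖ ≤ cd * mT * H := fun t ht' x => by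
    have h := norm_timeDeriv_mollifiedField_le_of_window hUv hℓ hℓ hℓ4 (hwin' t ht') x
    rw [hmax, Real.rpow_one] at h
    calc ‖FunctionSpaces.Torus.timeDeriv V (κ * t + c) x‖ ≤ cd * (ℓ⁻¹ * mT * (H * ℓ)) := h
      _ = cd * mT * H := by field_simp
  have hdxV : ∀ t ∈ Icc (0 : ℝ) T, ∀ x i, ‖FunctionSpaces.Torus.partialDeriv i (V (κ * t + c)) x‖ ≤ cd * g₁ * H := fun t ht' x i => by
    have h := norm_partialDeriv_mollifiedField_le hUv hℓ hℓ hℓ4 (hwin' t ht') x i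
    rw [hmax, Real.rpow_one] at h
    calc ‖FunctionSpaces.Torus.partialDeriv i (V (κ * t + c)) x‖ ≤ cd * (ℓ⁻¹ * g₁ * (H * ℓ)) := h
      _ = cd * g₁ * H := by field_simp
  have hddV : ∀ s x, ‖FunctionSpaces.Torus.timeDeriv (FunctionSpaces.Torus.timeDeriv V) s x‖ ≤ cd * (ℓ⁻¹ * ℓ⁻¹ * m₂ * B₀) :=
    fun s x => norm_timeDeriv_timeDeriv_mollifiedField_le hUv hℓ hℓ hℓ4 s x
  have hdxdV : ∀ s x l, ‖FunctionSpaces.Torus.partialDeriv l (FunctionSpaces.Torus.timeDeriv V s) x‖ ≤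
      cd * (ℓ⁻¹ * mT * (ℓ⁻¹ * g₁) * B₀) := fun s x l => norm_partialDeriv_timeDeriv_mollifiedField_le hUv hℓ hℓ hℓ4 hdVg s x l
  have hVsm : ∀ s, IsSmooth (V s) := fun s => isSmooth_mollifiedField hUi hℓ hℓ4 s
  have hFsm : ∀ s (j : d), IsSmooth (fun y => mollifiedFlux (timeBump hℓ) ℓ U s y j) := fun s j =>
    (FunctionSpaces.Torus.isSmoothSpaceTimeOn_of_contDiff (hFlg j) univ).isSmooth_slice (mem_univ s)
  have hdF : ∀ s x (j i : d), ‖FunctionSpaces.Torus.timeDeriv (fun τ' y => mollifiedFlux (timeBump hℓ) ℓ U τ' y j) s x i‖ ≤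
      ℓ⁻¹ * mT * B₀ ^ 2 := fun s x j i => norm_timeDeriv_mollifiedFlux_apply_le hUv hℓ hℓ hℓ4 s x j i
  have hdxF : ∀ s x (l j i : d), ‖FunctionSpaces.Torus.partialDeriv l (fun y => mollifiedFlux (timeBump hℓ) ℓ U s y j) x i‖ ≤
      ℓ⁻¹ * g₁ * B₀ ^ 2 := fun s x l j i => norm_partialDeriv_mollifiedFlux_apply_le hUv hℓ hℓ hℓ4 s x l j i
  have hcol_comm : ∀ t (j : d), (fun y => comm t y j) = fun y => V (κ * t + c) y j • V (κ * t + c) y - mollifiedFlux (timeBump hℓ) ℓ U (κ * t + c) y j :=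
    fun t j => by funext y; simp [hcommdef, tensorProd]
  refine ⟨fun t x => ?_, fun t ht' x => ?_, fun t ht' x i => ?_, fun t ht' x => ?_, fun t ht' x => ?_, fun t => ?_, fun t x => ?_,
    fun t x l => ?_, fun t x l m => ?_, fun t ht' x => ?_, fun t ht' x l => ?_, hψ, fun t x j => rfl, hcomms.traceless, hdefs,
    fun t x i j => traceless_symm (fun i j => hcsym t x i j) i j, fun t ht' x => ?_, fun t ht' x => ?_, fun t ht' x l => ?_,
    fun t ht' x => ?_, fun t ht' x l => ?_, fun t ht' x => ?_, fun t ht' x => ?_, fun t ht' hR x => ?_⟩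
  · -- `‖vm‖ ≤ cd B₀`
    have hB0 : 0 ≤ B₀ := hUv.M_nonneg
    calc ‖vm t x‖ = ‖V (κ * t + c) x‖ := rfl
      _ ≤ cd * B₀ := hb1 (κ * t + c) x
      _ ≤ C * B₀ := mul_le_mul_of_nonneg_right q1 hB0
  · -- `‖vm - v‖`
    have hτI : κ * t + c ∈ Icc (0 : ℝ) T := by obtain ⟨a1, a2⟩ := hτt t ht'; exact ⟨by linarith, by linarith⟩
    have e1 : vm t x - v t x = (V (κ * t + c) x - U (κ * t + c) x) + (v (κ * t + c) x - v t x) := by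
      rw [hUdef, zeroExt_of_mem v hτI]; simp [hvmdef, reparamVelocity, hVdef, hUdef]
    have h2' : ‖V (κ * t + c) x - U (κ * t + c) x‖ ≤ cd * (H * ℓ) := by
      have h := hb2 (κ * t + c) (hwin' t ht') x
      rwa [hmax, Real.rpow_one] at h
    have h3' : ‖v (κ * t + c) x - v t x‖ ≤ H * (6 * ℓ) := by
      have h := hUv.holder (κ * t + c) hτI t ht' x x
      rw [hUdef, zeroExt_of_mem v hτI, zeroExt_of_mem v ht', sub_self, norm_zero, Real.rpow_one,
        max_eq_left (abs_nonneg _)] at h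
      exact h.trans (mul_le_mul_of_nonneg_left (hdist t ht') hH0)
    calc ‖vm t x - v t x‖ ≤ cd * (H * ℓ) + H * (6 * ℓ) := by rw [e1]; exact (norm_add_le _ _).trans (add_le_add h2' h3')
      _ = (cd + 6) * H * ℓ := by ring
      _ ≤ (cd + 6) * (L * (Bt + B₁)) * ℓ := by gcongr
      _ = ((cd + 6) * L) * (Bt + B₁) * ℓ := by ring
      _ ≤ C * (Bt + B₁) * ℓ := by gcongr
  · -- `‖∂ᵢvm‖`
    have h := norm_partialDeriv_mollifiedField_le hUv hℓ hℓ hℓ4 (hwin' t ht') x i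
    rw [hmax, Real.rpow_one] at h
    calc ‖FunctionSpaces.Torus.partialDeriv i (vm t) x‖ ≤ cd * (ℓ⁻¹ * g₁ * (H * ℓ)) := h
      _ = cd * g₁ * H := by field_simp
      _ ≤ cd * g₁ * (L * (Bt + B₁)) := by gcongr
      _ = (cd * g₁ * L) * (Bt + B₁) := by ring
      _ ≤ C * (Bt + B₁) := by gcongr
  · -- `‖∂ₜvm‖`
    have hψ : ContDiff ℝ ∞ (stLift vm) := by
      have hφ : ContDiff ℝ ∞ (fun z : ℝ × EuclideanSpace ℝ d => (κ * z.1 + c, z.2)) :=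
        ((contDiff_const.mul contDiff_fst).add contDiff_const).prodMk contDiff_snd
      change ContDiff ℝ ∞ (stLift (mollifiedField (timeBump hℓ) ℓ U) ∘ fun z : ℝ × EuclideanSpace ℝ d => (κ * z.1 + c, z.2))
      exact hVg.comp hφ
    have e1 : FunctionSpaces.Torus.timeDerivWithin (Icc 0 T) vm t x = κ • FunctionSpaces.Torus.timeDeriv V (κ * t + c) x := by
      rw [FunctionSpaces.Torus.timeDerivWithin_eq_timeDeriv_of_contDiff hψ hU' ht' x, FunctionSpaces.Torus.timeDeriv,
        show (fun s' => vm s' x) = fun s' => mollifiedField (timeBump hℓ) ℓ U (κ * s' + c) x from rfl,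
        (hasDerivAt_comp_affine hVg κ c t x).deriv]
    have h := norm_timeDeriv_mollifiedField_le_of_window hUv hℓ hℓ hℓ4 (hwin' t ht') x
    rw [hmax, Real.rpow_one] at h
    rw [e1, norm_smul, Real.norm_eq_abs]
    calc |κ| * ‖FunctionSpaces.Torus.timeDeriv V (κ * t + c) x‖ ≤ 1 * (cd * (ℓ⁻¹ * mT * (H * ℓ))) :=
          mul_le_mul hκabs h (norm_nonneg _) zero_le_one
      _ = cd * mT * H := by field_simp
      _ ≤ cd * mT * (L * (Bt + B₁)) := by gcongr
      _ = (cd * mT * L) * (Bt + B₁) := by ring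
      _ ≤ C * (Bt + B₁) := by gcongr
  · -- `‖Rc‖`
    have hB0 : 0 ≤ B₀ := hUv.M_nonneg
    -- the commutator
    have hce : ∀ j i, ‖comm t x j i‖ ≤ 4 * B₀ * H * ℓ := fun j i => by
      have h := norm_mollifiedFlux_sub_mul_le hUv hℓ hℓ hℓ4 (hwin' t ht') x j i
      rw [hmax, Real.rpow_one] at h
      simp only [hcommdef, PiLp.sub_apply, tensorProd, PiLp.smul_apply, smul_eq_mul, hVdef]
      rw [← norm_neg, neg_sub]; exact h
    have hcn : ‖comm t x‖ ≤ cd * (4 * B₀ * H * ℓ) := pi_norm_le_of_forall_apply_apply_le (by positivity) hce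
    have htr : ‖traceless (comm t) x‖ ≤ (cd + 1) * (cd * (4 * B₀ * H * ℓ)) := by
      rw [traceless_eq_comp, Function.comp_apply]
      exact (norm_tracelessCLM_le _).trans (mul_le_mul_of_nonneg_left hcn (by positivity))
    -- the defect
    have hdn : ∀ y, ‖reparamDefect (timeBump hℓ) ℓ T κ c v t y‖ ≤ 4 * ℓ / T * (cd * (mT * H)) := fun y => by
      have h := norm_timeDeriv_mollifiedField_le_of_window hUv hℓ hℓ hℓ4 (hwin' t ht') y
      rw [hmax, Real.rpow_one] at h
      simp only [reparamDefect]
      rw [norm_smul, Real.norm_eq_abs, hκm1, ← hUdef]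
      have e2 : cd * (ℓ⁻¹ * mT * (H * ℓ)) = cd * (mT * H) := by field_simp
      exact mul_le_mul_of_nonneg_left (h.trans e2.le) (by positivity)
    have han : ‖antidivergence (reparamDefect (timeBump hℓ) ℓ T κ c v t) x‖ ≤ K * (4 * ℓ / T * (cd * (mT * H))) :=
      hK _ (hdefs.isSmooth_slice ht') _ (by positivity) hdn x
    have e1 : Rc t x = traceless (comm t) x + antidivergence (reparamDefect (timeBump hℓ) ℓ T κ c v t) x := by
      funext j; simp [hRcdef, hRdefdef]
    rw [e1]
    calc ‖traceless (comm t) x + antidivergence (reparamDefect (timeBump hℓ) ℓ T κ c v t) x‖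
        ≤ (cd + 1) * (cd * (4 * B₀ * H * ℓ)) + K * (4 * ℓ / T * (cd * (mT * H))) := (norm_add_le _ _).trans (add_le_add htr han)
      _ = (4 * (cd + 1) * cd) * B₀ * H * ℓ + (4 * K * cd * mT) * (1 / T) * H * ℓ := by ring
      _ ≤ (4 * (cd + 1) * cd * L) * B₀ * (Bt + B₁) * ℓ + (4 * K * cd * mT * L) * (1 / T) * (Bt + B₁) * ℓ := by
          have a1 : (4 * (cd + 1) * cd) * B₀ * H * ℓ ≤ (4 * (cd + 1) * cd) * B₀ * (L * (Bt + B₁)) * ℓ := by gcongr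
          have a2 : (4 * K * cd * mT) * (1 / T) * H * ℓ ≤ (4 * K * cd * mT) * (1 / T) * (L * (Bt + B₁)) * ℓ := by
            have : 0 ≤ 4 * K * cd * mT * (1 / T) := by positivity
            gcongr
          have e : (4 * (cd + 1) * cd * L) * B₀ * (Bt + B₁) * ℓ + (4 * K * cd * mT * L) * (1 / T) * (Bt + B₁) * ℓ =
              (4 * (cd + 1) * cd) * B₀ * (L * (Bt + B₁)) * ℓ + (4 * K * cd * mT) * (1 / T) * (L * (Bt + B₁)) * ℓ := by ring
          rw [e]; exact add_le_add a1 a2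
      _ ≤ (4 * (cd + 1) * cd * L + 4 * K * cd * mT * L) * (B₀ + 1 / T) * (Bt + B₁) * ℓ := by
          have hT1 : 0 ≤ 1 / T := by positivity
          have hBB : 0 ≤ Bt + B₁ := by positivity
          have c1nn : (0 : ℝ) ≤ 4 * (cd + 1) * cd * L := by positivity
          have c2nn : (0 : ℝ) ≤ 4 * K * cd * mT * L := by positivity
          have x1 := mul_nonneg (mul_nonneg (mul_nonneg c1nn hT1) hBB) hℓ.le
          have x2 := mul_nonneg (mul_nonneg (mul_nonneg c2nn hB0) hBB) hℓ.le
          have e : (4 * (cd + 1) * cd * L + 4 * K * cd * mT * L) * (B₀ + 1 / T) * (Bt + B₁) * ℓ =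
              (4 * (cd + 1) * cd * L) * B₀ * (Bt + B₁) * ℓ + (4 * K * cd * mT * L) * (1 / T) * (Bt + B₁) * ℓ +
              ((4 * (cd + 1) * cd * L) * (1 / T) * (Bt + B₁) * ℓ + (4 * K * cd * mT * L) * B₀ * (Bt + B₁) * ℓ) := by ring
          rw [e]; linarith
      _ ≤ C * (B₀ + 1 / T) * (Bt + B₁) * ℓ := by
          have hT1 : 0 ≤ B₀ + 1 / T := by positivity
          gcongr
  · -- `∫‖M‖ ≤ cd² δ`
    have hδ' : ∀ j i s, ∫ y, ‖RU s y j i‖ ≤ δ := by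
      intro j i s
      by_cases hs : s ∈ Icc 0 T
      · have hRs : IsSmooth (R s) := h.smooth_stress.isSmooth_slice hs
        calc ∫ y, ‖RU s y j i‖ ≤ ∫ y, ‖R s y‖ := by
              refine integral_mono (((continuous_apply j).comp hRs.continuous).norm.integrable_unitAddTorus.mono' ?_ ?_)
                hRs.continuous.norm.integrable_unitAddTorus fun y => ?_
              · exact ((continuous_euclidean_apply ((continuous_apply j).comp hRs.continuous) i).norm).aestronglyMeasurable.congr
                  (Eventually.of_forall fun y => by simp [hRUdef, zeroExt_of_mem R hs])
              · exact Eventually.of_forall fun y => by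
                  rw [norm_norm, hRUdef, zeroExt_of_mem R hs]; exact (PiLp.norm_apply_le (R s y j) i).trans (le_of_eq rfl) |>.trans le_rfl
              · show ‖RU s y j i‖ ≤ ‖R s y‖
                rw [hRUdef, zeroExt_of_mem R hs]
                exact (PiLp.norm_apply_le (R s y j) i).trans (norm_le_pi_norm (R s y) j)
          _ ≤ δ := hδ s hs
      · have hδ0 : 0 ≤ δ := le_trans (integral_nonneg fun y => norm_nonneg _) (hδ 0 ⟨le_rfl, hT.le⟩)
        simp only [hRUdef, zeroExt_of_not_mem R hs, Pi.zero_apply, PiLp.zero_apply, norm_zero, integral_zero]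
        exact hδ0
    have hMc : Continuous (M t) := (isSmooth_mollifiedStress' hcol hℓ hℓ hℓ4 (κ * t + c)).continuous
    have hent : ∀ j i, ∫ x, ‖M t x j i‖ ≤ δ := fun j i =>
      integral_norm_mollifiedField_apply_le (φ := timeBump hℓ) (hcol j).measurable (hcol j).bound (hcol j).zero_off hℓ hℓ4 i (hδ' j i) _
    have hδ0 : 0 ≤ δ := le_trans (integral_nonneg fun y => norm_nonneg _) (hent (Classical.arbitrary d) (Classical.arbitrary d))
    calc ∫ x, ‖M t x‖ ≤ ∫ x, ∑ j, ∑ i, ‖M t x j i‖ :=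
          integral_mono hMc.norm.integrable_unitAddTorus (by fun_prop : Continuous fun x => ∑ j, ∑ i, ‖M t x j i‖).integrable_unitAddTorus
            fun x => norm_tensor_le_sum_sum_abs (M t x)
      _ = ∑ j, ∑ i, ∫ x, ‖M t x j i‖ := by
          rw [integral_finsetSum _ fun j _ => (by fun_prop : Continuous fun x => ∑ i, ‖M t x j i‖).integrable_unitAddTorus]
          refine Finset.sum_congr rfl fun j _ => integral_finsetSum _ fun i _ => ?_
          exact (continuous_euclidean_apply ((continuous_apply j).comp hMc) i).norm.integrable_unitAddTorus
      _ ≤ ∑ _j : d, ∑ _i : d, δ := Finset.sum_le_sum fun j _ => Finset.sum_le_sum fun i _ => hent j i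
      _ = cd * cd * δ := by simp only [Finset.sum_const, Finset.card_univ, nsmul_eq_mul, hcd]; ring
      _ ≤ C * δ := mul_le_mul_of_nonneg_right q6 hδ0
  · -- `‖M‖`
    have hA0 : 0 ≤ A := (hcol (Classical.arbitrary d)).M_nonneg
    calc ‖M t x‖ ≤ cd * A := norm_mollifiedStress_le hcol hℓ hℓ hℓ4 (κ * t + c) x
      _ ≤ C * A := mul_le_mul_of_nonneg_right q1 hA0
  · -- `‖∂M‖`
    have hA0 : 0 ≤ A := (hcol (Classical.arbitrary d)).M_nonneg
    calc ‖FunctionSpaces.Torus.partialDeriv l (M t) x‖ ≤ cd * (ℓ⁻¹ * g₁ * A) := norm_partialDeriv_mollifiedStress_le hcol hℓ hℓ hℓ4 (κ * t + c) x l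
      _ = (cd * g₁) * A * ℓ⁻¹ := by ring
      _ ≤ C * A * ℓ⁻¹ := by gcongr
  · -- `‖∂∂M‖`
    have hA0 : 0 ≤ A := (hcol (Classical.arbitrary d)).M_nonneg
    calc ‖FunctionSpaces.Torus.partialDeriv l (FunctionSpaces.Torus.partialDeriv m (M t)) x‖ ≤ cd * ((ℓ ^ 2)⁻¹ * g₂ * A) :=
          norm_partialDeriv_partialDeriv_mollifiedStress_le hcol hℓ hℓ hℓ4 (κ * t + c) x l m
      _ = (cd * g₂) * A * ℓ⁻¹ ^ 2 := by rw [inv_pow]; ring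
      _ ≤ C * A * ℓ⁻¹ ^ 2 := by gcongr
  · -- `‖∂ₜM‖`
    have hA0 : 0 ≤ A := (hcol (Classical.arbitrary d)).M_nonneg
    obtain ⟨D, hD, hDb⟩ := hasDerivAt_mollifiedStress_comp_affine hcol hℓ hℓ hℓ4 κ c t x
    have e1 : FunctionSpaces.Torus.timeDerivWithin (Icc 0 T) M t x = κ • D := by
      show derivWithin (fun s => M s x) (Icc 0 T) t = κ • D
      exact hD.hasDerivWithinAt.derivWithin (hU' t ht')
    rw [e1, norm_smul, Real.norm_eq_abs]
    calc |κ| * ‖D‖ ≤ 1 * (cd * (ℓ⁻¹ * mT * A)) := mul_le_mul hκabs hDb (norm_nonneg _) zero_le_one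
      _ = (cd * mT) * A * ℓ⁻¹ := by ring
      _ ≤ C * A * ℓ⁻¹ := by gcongr
  · -- `‖∂ₜ∂M‖`
    have hA0 : 0 ≤ A := (hcol (Classical.arbitrary d)).M_nonneg
    obtain ⟨D, hD, hDb⟩ := hasDerivAt_partialDeriv_mollifiedStress_comp_affine hcol hℓ hℓ hℓ4 κ c t x l
    have e1 : FunctionSpaces.Torus.timeDerivWithin (Icc 0 T) (fun s y => FunctionSpaces.Torus.partialDeriv l (M s) y) t x = κ • D := by
      show derivWithin (fun s => FunctionSpaces.Torus.partialDeriv l (M s) x) (Icc 0 T) t = κ • D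
      exact hD.hasDerivWithinAt.derivWithin (hU' t ht')
    rw [e1, norm_smul, Real.norm_eq_abs]
    calc |κ| * ‖D‖ ≤ 1 * (cd * (ℓ⁻¹ * mT * (ℓ⁻¹ * g₁) * A)) := mul_le_mul hκabs hDb (norm_nonneg _) zero_le_one
      _ = (cd * mT * g₁) * A * ℓ⁻¹ ^ 2 := by ring
      _ ≤ C * A * ℓ⁻¹ ^ 2 := by gcongr
  · -- `‖Rcm‖`
    have hce : ∀ j i, ‖comm t x j i‖ ≤ 4 * B₀ * H * ℓ := fun j i => by
      have h := norm_mollifiedFlux_sub_mul_le hUv hℓ hℓ hℓ4 (hwin' t ht') x j i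
      rw [hmax, Real.rpow_one] at h
      simp only [hcommdef, PiLp.sub_apply, tensorProd, PiLp.smul_apply, smul_eq_mul, hVdef]
      rw [← norm_neg, neg_sub]; exact h
    have hcn : ‖comm t x‖ ≤ cd * (4 * B₀ * H * ℓ) := pi_norm_le_of_forall_apply_apply_le (by positivity) hce
    calc ‖Rcm t x‖ = ‖traceless (comm t) x‖ := rfl
      _ ≤ (cd + 1) * (cd * (4 * B₀ * H * ℓ)) := by
          rw [traceless_eq_comp, Function.comp_apply]
          exact (norm_tracelessCLM_le _).trans (mul_le_mul_of_nonneg_left hcn (by positivity))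
      _ = (4 * (cd + 1) * cd) * B₀ * H * ℓ := by ring
      _ ≤ (4 * (cd + 1) * cd) * B₀ * (L * (Bt + B₁)) * ℓ := by gcongr
      _ = (4 * (cd + 1) * cd * L) * B₀ * (Bt + B₁) * ℓ := by ring
      _ ≤ C * B₀ * (Bt + B₁) * ℓ := by gcongr
  · -- `‖Rdef‖`
    have h := norm_timeDeriv_mollifiedField_le_of_window hUv hℓ hℓ hℓ4 (hwin' t ht') x
    rw [hmax, Real.rpow_one] at h
    have e2 : cd * (ℓ⁻¹ * mT * (H * ℓ)) = cd * (mT * H) := by field_simp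
    calc ‖Rdef t x‖ = |κ - 1| * ‖FunctionSpaces.Torus.timeDeriv (mollifiedField (timeBump hℓ) ℓ U) (κ * t + c) x‖ := by
          simp only [hRdefdef, reparamDefect, hUdef]; rw [norm_smul, Real.norm_eq_abs]
      _ ≤ 4 * ℓ / T * (cd * (mT * H)) := by rw [hκm1]; exact mul_le_mul_of_nonneg_left (h.trans e2.le) (by positivity)
      _ = (4 * cd * mT) * (1 / T) * H * ℓ := by ring
      _ ≤ (4 * cd * mT) * (1 / T) * (L * (Bt + B₁)) * ℓ := by
          have : 0 ≤ (4 * cd * mT) * (1 / T) := by positivity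
          gcongr
      _ = (4 * cd * mT * L) * (1 / T) * (Bt + B₁) * ℓ := by ring
      _ ≤ C * (1 / T) * (Bt + B₁) * ℓ := by
          have : 0 ≤ 1 / T := by positivity
          gcongr
  · -- `‖∂ₗ Rcm‖`
    have hS : IsSmooth (comm t) := hcomms.isSmooth_slice ht'
    have hVt : IsSmooth (V (κ * t + c)) := hVsm _
    have hV1 : IsContDiff 1 (V (κ * t + c)) := hVt.isContDiff (by simp)
    have hcolb : ∀ j, ‖FunctionSpaces.Torus.partialDeriv l (comm t) x j‖ ≤ 2 * (cd * B₀) * (cd * g₁ * H) + cd * (ℓ⁻¹ * g₁ * B₀ ^ 2) := by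
      intro j
      have hVj : IsContDiff 1 (fun y => V (κ * t + c) y j) := (EuclideanSpace.proj j : EuclideanSpace ℝ d →L[ℝ] ℝ).contDiff.comp hV1
      have hPj : IsContDiff 1 (fun y => V (κ * t + c) y j • V (κ * t + c) y) := ContDiff.smul hVj hV1
      have hFj : IsContDiff 1 (fun y => mollifiedFlux (timeBump hℓ) ℓ U (κ * t + c) y j) := (hFsm _ j).isContDiff (by simp)
      rw [partialDeriv_tensor_apply hS l x j, hcol_comm t j, partialDeriv_sub_at hPj hFj l x,
        FunctionSpaces.Torus.partialDeriv_smul hVj hV1 l x, FunctionSpaces.Torus.partialDeriv_apply_coord hV1 l x j]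
      have a1 : ‖V (κ * t + c) x j‖ ≤ cd * B₀ := (PiLp.norm_apply_le (V (κ * t + c) x) j).trans (hb1 _ x)
      have a2 : ‖FunctionSpaces.Torus.partialDeriv l (V (κ * t + c)) x‖ ≤ cd * g₁ * H := hdxV t ht' x l
      have a3 : ‖FunctionSpaces.Torus.partialDeriv l (V (κ * t + c)) x j‖ ≤ cd * g₁ * H := (PiLp.norm_apply_le _ j).trans a2
      have a4 : ‖V (κ * t + c) x‖ ≤ cd * B₀ := hb1 _ x
      have a5 : ‖FunctionSpaces.Torus.partialDeriv l (fun y => mollifiedFlux (timeBump hℓ) ℓ U (κ * t + c) y j) x‖ ≤ cd * (ℓ⁻¹ * g₁ * B₀ ^ 2) :=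
        euclidean_norm_le_of_forall_apply_le fun i => hdxF _ x l j i
      calc ‖V (κ * t + c) x j • FunctionSpaces.Torus.partialDeriv l (V (κ * t + c)) x +
            FunctionSpaces.Torus.partialDeriv l (V (κ * t + c)) x j • V (κ * t + c) x -
            FunctionSpaces.Torus.partialDeriv l (fun y => mollifiedFlux (timeBump hℓ) ℓ U (κ * t + c) y j) x‖
          ≤ ‖V (κ * t + c) x j‖ * ‖FunctionSpaces.Torus.partialDeriv l (V (κ * t + c)) x‖ +
            ‖FunctionSpaces.Torus.partialDeriv l (V (κ * t + c)) x j‖ * ‖V (κ * t + c) x‖ +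
            ‖FunctionSpaces.Torus.partialDeriv l (fun y => mollifiedFlux (timeBump hℓ) ℓ U (κ * t + c) y j) x‖ := by
            refine (norm_sub_le _ _).trans (add_le_add ((norm_add_le _ _).trans (add_le_add ?_ ?_)) le_rfl)
            · rw [norm_smul]
            · rw [norm_smul]
        _ ≤ (cd * B₀) * (cd * g₁ * H) + (cd * g₁ * H) * (cd * B₀) + cd * (ℓ⁻¹ * g₁ * B₀ ^ 2) := by
            gcongr
        _ = 2 * (cd * B₀) * (cd * g₁ * H) + cd * (ℓ⁻¹ * g₁ * B₀ ^ 2) := by ring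
    have hnn : 0 ≤ 2 * (cd * B₀) * (cd * g₁ * H) + cd * (ℓ⁻¹ * g₁ * B₀ ^ 2) := by positivity
    have hcomm' : ‖FunctionSpaces.Torus.partialDeriv l (comm t) x‖ ≤ 2 * (cd * B₀) * (cd * g₁ * H) + cd * (ℓ⁻¹ * g₁ * B₀ ^ 2) :=
      (pi_norm_le_iff_of_nonneg hnn).2 hcolb
    have e1 : FunctionSpaces.Torus.partialDeriv l (Rcm t) x = tracelessCLM (FunctionSpaces.Torus.partialDeriv l (comm t) x) := by
      show FunctionSpaces.Torus.partialDeriv l (traceless (comm t)) x = _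
      rw [traceless_eq_comp, FunctionSpaces.Torus.partialDeriv_clm_comp hS]
    rw [e1]
    calc ‖tracelessCLM (FunctionSpaces.Torus.partialDeriv l (comm t) x)‖
        ≤ (cd + 1) * (2 * (cd * B₀) * (cd * g₁ * H) + cd * (ℓ⁻¹ * g₁ * B₀ ^ 2)) :=
          (norm_tracelessCLM_le _).trans (mul_le_mul_of_nonneg_left hcomm' (by positivity))
      _ ≤ (cd + 1) * (2 * (cd * B₀) * (cd * g₁ * (L * (Bt + B₁))) + cd * (ℓ⁻¹ * g₁ * B₀ ^ 2)) := by gcongr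
      _ = (cd + 1) * (2 * cd * cd * g₁ * L) * (B₀ * (Bt + B₁)) + (cd + 1) * (cd * g₁) * (B₀ * (B₀ * ℓ⁻¹)) := by ring
      _ ≤ (cd + 1) * (2 * cd * cd * g₁ * L + cd * g₁) * (B₀ * (Bt + B₁)) +
            (cd + 1) * (2 * cd * cd * g₁ * L + cd * g₁) * (B₀ * (B₀ * ℓ⁻¹)) := by
          have w1 : 0 ≤ B₀ * (Bt + B₁) := by positivity
          have w2 : 0 ≤ B₀ * (B₀ * ℓ⁻¹) := by positivity
          have w0 : 0 ≤ cd + 1 := by positivity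
          have w3 : (cd + 1) * (2 * cd * cd * g₁ * L) ≤ (cd + 1) * (2 * cd * cd * g₁ * L + cd * g₁) :=
            mul_le_mul_of_nonneg_left (le_add_of_nonneg_right p7) w0
          have w4 : (cd + 1) * (cd * g₁) ≤ (cd + 1) * (2 * cd * cd * g₁ * L + cd * g₁) :=
            mul_le_mul_of_nonneg_left (le_add_of_nonneg_left (by positivity)) w0
          exact add_le_add (mul_le_mul_of_nonneg_right w3 w1) (mul_le_mul_of_nonneg_right w4 w2)
      _ = (cd + 1) * (2 * cd * cd * g₁ * L + cd * g₁) * B₀ * (B₀ * ℓ⁻¹ + (Bt + B₁)) := by ring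
      _ ≤ C * B₀ * (B₀ * ℓ⁻¹ + (Bt + B₁)) := by
          have : 0 ≤ B₀ * ℓ⁻¹ + (Bt + B₁) := by positivity
          gcongr
  · -- `‖∂ₜ Rcm‖`
    -- derivative of the columns of the commutator along the affine time map
    have hVd : HasDerivAt (fun s => V (κ * s + c) x) (κ • FunctionSpaces.Torus.timeDeriv V (κ * t + c) x) t := hasDerivAt_comp_affine hVg κ c t x
    have hcold : ∀ j : d, HasDerivAt (fun s => comm s x j)
        ((κ • FunctionSpaces.Torus.timeDeriv V (κ * t + c) x) j • V (κ * t + c) x + V (κ * t + c) x j • (κ • FunctionSpaces.Torus.timeDeriv V (κ * t + c) x) -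
          κ • FunctionSpaces.Torus.timeDeriv (fun τ' y => mollifiedFlux (timeBump hℓ) ℓ U τ' y j) (κ * t + c) x) t := by
      intro j
      have hVjd : HasDerivAt (fun s => V (κ * s + c) x j) ((κ • FunctionSpaces.Torus.timeDeriv V (κ * t + c) x) j) t :=
        (EuclideanSpace.proj j : EuclideanSpace ℝ d →L[ℝ] ℝ).hasFDerivAt.comp_hasDerivAt t hVd
      have hFd : HasDerivAt (fun s => mollifiedFlux (timeBump hℓ) ℓ U (κ * s + c) x j)
          (κ • FunctionSpaces.Torus.timeDeriv (fun τ' y => mollifiedFlux (timeBump hℓ) ℓ U τ' y j) (κ * t + c) x) t :=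
        hasDerivAt_comp_affine (hFlg j) κ c t x
      have h := (hVjd.smul hVd).sub hFd
      have e : (fun s => comm s x j) = fun s => V (κ * s + c) x j • V (κ * s + c) x - mollifiedFlux (timeBump hℓ) ℓ U (κ * s + c) x j := by
        funext s; simp [hcommdef, tensorProd]
      rw [e]
      convert h using 1 <;> first | rfl | abel
    have hcommd := hasDerivAt_pi.2 hcold
    have hRd : HasDerivAt (fun s => Rcm s x) (tracelessCLM fun j =>
        ((κ • FunctionSpaces.Torus.timeDeriv V (κ * t + c) x) j • V (κ * t + c) x + V (κ * t + c) x j • (κ • FunctionSpaces.Torus.timeDeriv V (κ * t + c) x) -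
          κ • FunctionSpaces.Torus.timeDeriv (fun τ' y => mollifiedFlux (timeBump hℓ) ℓ U τ' y j) (κ * t + c) x)) t := by
      have e : (fun s => Rcm s x) = fun s => tracelessCLM (comm s x) := by
        funext s; show traceless (comm s) x = _; rw [traceless_eq_comp]; rfl
      rw [e]
      exact tracelessCLM.hasFDerivAt.comp_hasDerivAt t hcommd
    have e1 : FunctionSpaces.Torus.timeDerivWithin (Icc 0 T) Rcm t x = tracelessCLM (fun j =>
        ((κ • FunctionSpaces.Torus.timeDeriv V (κ * t + c) x) j • V (κ * t + c) x + V (κ * t + c) x j • (κ • FunctionSpaces.Torus.timeDeriv V (κ * t + c) x) -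
          κ • FunctionSpaces.Torus.timeDeriv (fun τ' y => mollifiedFlux (timeBump hℓ) ℓ U τ' y j) (κ * t + c) x)) :=
      hRd.hasDerivWithinAt.derivWithin (hU' t ht')
    have hcolb : ∀ j : d, ‖((κ • FunctionSpaces.Torus.timeDeriv V (κ * t + c) x) j • V (κ * t + c) x + V (κ * t + c) x j • (κ • FunctionSpaces.Torus.timeDeriv V (κ * t + c) x) -
          κ • FunctionSpaces.Torus.timeDeriv (fun τ' y => mollifiedFlux (timeBump hℓ) ℓ U τ' y j) (κ * t + c) x)‖ ≤
        2 * (cd * mT * H) * (cd * B₀) + cd * (ℓ⁻¹ * mT * B₀ ^ 2) := by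
      intro j
      have a0 : ‖κ • FunctionSpaces.Torus.timeDeriv V (κ * t + c) x‖ ≤ cd * mT * H := by
        rw [norm_smul, Real.norm_eq_abs]
        calc |κ| * ‖FunctionSpaces.Torus.timeDeriv V (κ * t + c) x‖ ≤ 1 * (cd * mT * H) := mul_le_mul hκabs (hdV t ht' x) (norm_nonneg _) zero_le_one
          _ = cd * mT * H := one_mul _
      have a1 : ‖(κ • FunctionSpaces.Torus.timeDeriv V (κ * t + c) x) j‖ ≤ cd * mT * H := (PiLp.norm_apply_le _ j).trans a0
      have a2 : ‖V (κ * t + c) x‖ ≤ cd * B₀ := hb1 _ x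
      have a3 : ‖V (κ * t + c) x j‖ ≤ cd * B₀ := (PiLp.norm_apply_le _ j).trans a2
      have a4 : ‖κ • FunctionSpaces.Torus.timeDeriv (fun τ' y => mollifiedFlux (timeBump hℓ) ℓ U τ' y j) (κ * t + c) x‖ ≤ cd * (ℓ⁻¹ * mT * B₀ ^ 2) := by
        rw [norm_smul, Real.norm_eq_abs]
        calc |κ| * ‖FunctionSpaces.Torus.timeDeriv (fun τ' y => mollifiedFlux (timeBump hℓ) ℓ U τ' y j) (κ * t + c) x‖
            ≤ 1 * (cd * (ℓ⁻¹ * mT * B₀ ^ 2)) :=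
              mul_le_mul hκabs (euclidean_norm_le_of_forall_apply_le fun i => hdF (κ * t + c) x j i) (norm_nonneg _) zero_le_one
          _ = cd * (ℓ⁻¹ * mT * B₀ ^ 2) := one_mul _
      calc ‖((κ • FunctionSpaces.Torus.timeDeriv V (κ * t + c) x) j • V (κ * t + c) x + V (κ * t + c) x j • (κ • FunctionSpaces.Torus.timeDeriv V (κ * t + c) x) -
            κ • FunctionSpaces.Torus.timeDeriv (fun τ' y => mollifiedFlux (timeBump hℓ) ℓ U τ' y j) (κ * t + c) x)‖
          ≤ ‖(κ • FunctionSpaces.Torus.timeDeriv V (κ * t + c) x) j‖ * ‖V (κ * t + c) x‖ + ‖V (κ * t + c) x j‖ * ‖κ • FunctionSpaces.Torus.timeDeriv V (κ * t + c) x‖ +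
            ‖κ • FunctionSpaces.Torus.timeDeriv (fun τ' y => mollifiedFlux (timeBump hℓ) ℓ U τ' y j) (κ * t + c) x‖ := by
            refine (norm_sub_le _ _).trans (add_le_add ((norm_add_le _ _).trans (add_le_add ?_ ?_)) le_rfl)
            · rw [norm_smul]
            · rw [norm_smul]
        _ ≤ (cd * mT * H) * (cd * B₀) + (cd * B₀) * (cd * mT * H) + cd * (ℓ⁻¹ * mT * B₀ ^ 2) := by gcongr
        _ = 2 * (cd * mT * H) * (cd * B₀) + cd * (ℓ⁻¹ * mT * B₀ ^ 2) := by ring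
    have hnn : 0 ≤ 2 * (cd * mT * H) * (cd * B₀) + cd * (ℓ⁻¹ * mT * B₀ ^ 2) := by positivity
    rw [e1]
    calc ‖tracelessCLM (fun j =>
          ((κ • FunctionSpaces.Torus.timeDeriv V (κ * t + c) x) j • V (κ * t + c) x + V (κ * t + c) x j • (κ • FunctionSpaces.Torus.timeDeriv V (κ * t + c) x) -
            κ • FunctionSpaces.Torus.timeDeriv (fun τ' y => mollifiedFlux (timeBump hℓ) ℓ U τ' y j) (κ * t + c) x))‖
        ≤ (cd + 1) * (2 * (cd * mT * H) * (cd * B₀) + cd * (ℓ⁻¹ * mT * B₀ ^ 2)) :=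
          (norm_tracelessCLM_le _).trans (mul_le_mul_of_nonneg_left ((pi_norm_le_iff_of_nonneg hnn).2 hcolb) (by positivity))
      _ ≤ (cd + 1) * (2 * (cd * mT * (L * (Bt + B₁))) * (cd * B₀) + cd * (ℓ⁻¹ * mT * B₀ ^ 2)) := by gcongr
      _ = (cd + 1) * (2 * cd * cd * mT * L) * (B₀ * (Bt + B₁)) + (cd + 1) * (cd * mT) * (B₀ * (B₀ * ℓ⁻¹)) := by ring
      _ ≤ (cd + 1) * (2 * cd * cd * mT * L + cd * mT) * (B₀ * (Bt + B₁)) +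
            (cd + 1) * (2 * cd * cd * mT * L + cd * mT) * (B₀ * (B₀ * ℓ⁻¹)) := by
          have w1 : 0 ≤ B₀ * (Bt + B₁) := by positivity
          have w2 : 0 ≤ B₀ * (B₀ * ℓ⁻¹) := by positivity
          have w0 : 0 ≤ cd + 1 := by positivity
          have w3 : (cd + 1) * (2 * cd * cd * mT * L) ≤ (cd + 1) * (2 * cd * cd * mT * L + cd * mT) :=
            mul_le_mul_of_nonneg_left (le_add_of_nonneg_right p9) w0
          have w4 : (cd + 1) * (cd * mT) ≤ (cd + 1) * (2 * cd * cd * mT * L + cd * mT) :=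
            mul_le_mul_of_nonneg_left (le_add_of_nonneg_left (by positivity)) w0
          exact add_le_add (mul_le_mul_of_nonneg_right w3 w1) (mul_le_mul_of_nonneg_right w4 w2)
      _ = (cd + 1) * (2 * cd * cd * mT * L + cd * mT) * B₀ * (B₀ * ℓ⁻¹ + (Bt + B₁)) := by ring
      _ ≤ C * B₀ * (B₀ * ℓ⁻¹ + (Bt + B₁)) := by
          have : 0 ≤ B₀ * ℓ⁻¹ + (Bt + B₁) := by positivity
          gcongr
  · -- `‖∂ₗ Rdef‖`
    have hsm : IsSmooth (FunctionSpaces.Torus.timeDeriv V (κ * t + c)) :=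
      (FunctionSpaces.Torus.isSmoothSpaceTimeOn_of_contDiff hdVg univ).isSmooth_slice (mem_univ _)
    have e1 : Rdef t = (κ - 1) • FunctionSpaces.Torus.timeDeriv V (κ * t + c) := by
      funext y; simp [hRdefdef, reparamDefect, hVdef, hUdef]
    rw [e1, FunctionSpaces.Torus.partialDeriv_const_smul (hsm.isContDiff (by simp)), Pi.smul_apply, norm_smul,
      Real.norm_eq_abs, hκm1]
    calc 4 * ℓ / T * ‖FunctionSpaces.Torus.partialDeriv l (FunctionSpaces.Torus.timeDeriv V (κ * t + c)) x‖
        ≤ 4 * ℓ / T * (cd * (ℓ⁻¹ * mT * (ℓ⁻¹ * g₁) * B₀)) := mul_le_mul_of_nonneg_left (hdxdV _ x l) (by positivity)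
      _ = (4 * cd * mT * g₁) * (1 / T) * B₀ * ℓ⁻¹ := by field_simp
      _ ≤ C * (1 / T) * B₀ * ℓ⁻¹ := by
          have : 0 ≤ 1 / T := by positivity
          gcongr
  · -- `‖∂ₜ Rdef‖`
    have hd1 : HasDerivAt (fun s => FunctionSpaces.Torus.timeDeriv V (κ * s + c) x)
        (κ • FunctionSpaces.Torus.timeDeriv (FunctionSpaces.Torus.timeDeriv V) (κ * t + c) x) t :=
      hasDerivAt_comp_affine hdVg κ c t x
    have hd2 : HasDerivAt (fun s => Rdef s x)
        ((κ - 1) • (κ • FunctionSpaces.Torus.timeDeriv (FunctionSpaces.Torus.timeDeriv V) (κ * t + c) x)) t := by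
      have e : (fun s => Rdef s x) = fun s => (κ - 1) • FunctionSpaces.Torus.timeDeriv V (κ * s + c) x := by
        funext s; simp [hRdefdef, reparamDefect, hVdef, hUdef]
      rw [e]
      exact hd1.const_smul (κ - 1)
    have e1 : FunctionSpaces.Torus.timeDerivWithin (Icc 0 T) Rdef t x =
        (κ - 1) • (κ • FunctionSpaces.Torus.timeDeriv (FunctionSpaces.Torus.timeDeriv V) (κ * t + c) x) :=
      hd2.hasDerivWithinAt.derivWithin (hU' t ht')
    rw [e1, norm_smul, norm_smul, Real.norm_eq_abs, Real.norm_eq_abs, hκm1]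
    calc 4 * ℓ / T * (|κ| * ‖FunctionSpaces.Torus.timeDeriv (FunctionSpaces.Torus.timeDeriv V) (κ * t + c) x‖)
        ≤ 4 * ℓ / T * (1 * (cd * (ℓ⁻¹ * ℓ⁻¹ * m₂ * B₀))) :=
          mul_le_mul_of_nonneg_left (mul_le_mul hκabs (hddV _ x) (norm_nonneg _) zero_le_one) (by positivity)
      _ = (4 * cd * m₂) * (1 / T) * B₀ * ℓ⁻¹ := by field_simp
      _ ≤ C * (1 / T) * B₀ * ℓ⁻¹ := by
          have : 0 ≤ 1 / T := by positivity
          gcongr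
  · -- `‖∂ₜ∂ₜ vm‖`
    have hin : ∀ s ∈ Icc (0 : ℝ) T, FunctionSpaces.Torus.timeDerivWithin (Icc 0 T) vm s x = κ • FunctionSpaces.Torus.timeDeriv V (κ * s + c) x := by
      intro s hs
      rw [FunctionSpaces.Torus.timeDerivWithin_eq_timeDeriv_of_contDiff hψ hU' hs x, FunctionSpaces.Torus.timeDeriv,
        show (fun s' => vm s' x) = fun s' => mollifiedField (timeBump hℓ) ℓ U (κ * s' + c) x from rfl,
        (hasDerivAt_comp_affine hVg κ c s x).deriv]
    have hd1 : HasDerivAt (fun s => κ • FunctionSpaces.Torus.timeDeriv V (κ * s + c) x)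
        (κ • (κ • FunctionSpaces.Torus.timeDeriv (FunctionSpaces.Torus.timeDeriv V) (κ * t + c) x)) t :=
      (hasDerivAt_comp_affine hdVg κ c t x).const_smul κ
    have e1 : FunctionSpaces.Torus.timeDerivWithin (Icc 0 T) (FunctionSpaces.Torus.timeDerivWithin (Icc 0 T) vm) t x =
        κ • (κ • FunctionSpaces.Torus.timeDeriv (FunctionSpaces.Torus.timeDeriv V) (κ * t + c) x) := by
      show derivWithin (fun s => FunctionSpaces.Torus.timeDerivWithin (Icc 0 T) vm s x) (Icc 0 T) t = _
      rw [derivWithin_congr (fun s hs => hin s hs) (hin t ht')]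
      exact hd1.hasDerivWithinAt.derivWithin (hU' t ht')
    rw [e1, norm_smul, norm_smul, Real.norm_eq_abs]
    calc |κ| * (|κ| * ‖FunctionSpaces.Torus.timeDeriv (FunctionSpaces.Torus.timeDeriv V) (κ * t + c) x‖)
        ≤ 1 * (1 * (cd * (ℓ⁻¹ * ℓ⁻¹ * m₂ * B₀))) :=
          mul_le_mul hκabs (mul_le_mul hκabs (hddV _ x) (norm_nonneg _) zero_le_one) (by positivity) zero_le_one
      _ = (cd * m₂) * B₀ * ℓ⁻¹ ^ 2 := by ring
      _ ≤ C * B₀ * ℓ⁻¹ ^ 2 := by gcongr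
  · -- locality of `M`
    have key : ∀ j i, M t x j i = 0 := by
      intro j i
      show mollifiedStress (timeBump hℓ) ℓ RU (κ * t + c) x j i = 0
      rw [mollifiedStress_apply, FunctionSpaces.Torus.mollifiedField_apply]
      have hz : timeAvgWith ((timeBump hℓ).normed volume) (fun s y => RU s y j i) (κ * t + c) = 0 := by
        funext y
        rw [FunctionSpaces.timeAvgWith_apply]
        refine integral_eq_zero_of_ae (Eventually.of_forall fun s => ?_)
        by_cases hs : ℓ < |s|
        · simp [(FunctionSpaces.Torus.timeBump_normed_eq_zero hℓ hs).1]
        · have hs' : |s| ≤ ℓ := not_lt.1 hs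
          obtain ⟨hs1, hs2⟩ := abs_le.1 hs'
          have hmem : κ * t + c - s ∈ Icc (0 : ℝ) T := hwin' t ht' ⟨by linarith, by linarith⟩
          have hdist' : |κ * t + c - s - t| ≤ 7 * ℓ := by
            have h1 := hdist t ht'
            calc |κ * t + c - s - t| = |(κ * t + c - t) + (-s)| := by ring_nf
              _ ≤ |κ * t + c - t| + |-s| := abs_add_le _ _
              _ ≤ 6 * ℓ + ℓ := by rw [abs_neg]; exact add_le_add h1 hs'
              _ = 7 * ℓ := by ring
          have h0 : R (κ * t + c - s) y = 0 := hR _ hmem hdist' y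
          simp [hRUdef, zeroExt_of_mem R hmem, h0]
      rw [hz, zero_convolution]
      rfl
    funext j
    ext i
    rw [key j i]
    rfl

end Package

end Torus

end Literature.Analysis.FluidPDE

end
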